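import Summits.ResolutionOfSingularities.ResolutionOfSingularities.Theorems.FrobeniusLadderFInjectiveMacaulayficationS2ModificationAffineRadical
import Mathlib.RingTheory.Localization.Integral
import Mathlib.RingTheory.Localization.LocalizationLocalization
import Mathlib.RingTheory.Localization.AtPrime.Basic
import HarnessLib

/-!
# The affine S₂-modification algebra commutes with localisation — file L2 of the `S2Modification` discharge
# (crux `FInjectiveMacaulayfication` stmt-ResolutionOfSingularities-15315, chain w45a, hole #3γ/FC″, rung r2 input S-S2
# `FCForallExistsDimLe2.S2Modification`; sequel to `…S2ModificationAffine` p548522 (the object `A′`) and `…S2ModificationAffineRadical`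
# p549996 (`A′` depends only on `V(s)`); res-L1-w45a-plan-1 R14.3 (4) «stub-2's object is L2»; memo `D/res-D-pv-019/S2MOD-MEMO.md` §3 L2;
# seat res-L1-w45a-stub-2)

[OURS · L1 W4.5a] Support file (`--supports stmt-ResolutionOfSingularities-15315 --as helper`); NOT a statement of any manuscript; no named
fact; no definitions; AI-written (AI review is weaker than expert review).

THE STATEMENT. `A` a domain with fraction field `K`, `s` a finite set of non-zero elements, `A′ = Ā ∩ ⋂_{f ∈ s} A[1/f] ⊆ K`
(`S2ModificationAffine.s2Mod A K s hs`). Let `B = M⁻¹A` be ANY localisation of `A` sitting in the tower `A → B → K`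
(`[IsLocalization M B] [IsScalarTower A B K]`; `K` is then also the fraction field of `B`), and let `s′ ⊆ B` be any finite set of
non-zero elements generating an ideal with the same radical as `(s)·B` (the closed set `V(s) ∩ Spec B`). Then, inside `K`,

  `(M⁻¹A)′ = M⁻¹(A′)`:  `x ∈ s2Mod B K s′ _ ↔ ∃ m ∈ M, m·x ∈ s2Mod A K s hs`   (`mem_s2Mod_iff_exists_mul_mem`).

Ingredients: integral closure commutes with localisation (Mathlib `IsIntegral.exists_multiple_integral_of_isLocalization`), each
`A[1/f]` localises to `B[1/f]`, and a FINITE intersection of `A`-subalgebras of `K` commutes with `M⁻¹` (one common denominator, the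
product over the index set) — `exists_mul_forall_mem`.

PACKAGED FORMS (what L3 = stalks over `V(𝔟)` and L4 = the relative-Spec gluing consume; all def-free):
* `s2Mod_le_restrictScalars` — `A′ ⊆ B′` for ANY intermediate ring `A ⊆ B ⊆ K` (no localisation hypothesis);
* `restrictScalars_s2Mod_eq_sup` — `(M⁻¹A)′ = A′ · B` as `A`-subalgebras of `K`;
* `isLocalization_s2Mod` — under any algebra `A′ → (M⁻¹A)′` compatible with the two inclusions into `K`, `(M⁻¹A)′` IS the
  localisation of the ring `A′` at (the image of) `M` (`IsLocalization`); `exists_algHom_s2Mod` supplies such an algebra map;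
* `mem_s2Mod_awaySub_iff` — the basic-open case `B = A[1/t]` (`awaySub A K t ht`): `x ∈ (A[1/t])′ ↔ ∃ n, tⁿ·x ∈ A′`, i.e.
  `Γ(D(t), 𝒜) = A′[1/t]` — the sheaf `𝒜` of memo §2 is quasi-coherent and its value on an affine open depends only on that open;
* OFF `V(𝔟)`: if `M` meets `s` (e.g. `M = A ∖ 𝔭` with `𝔭 ⊉ (s)`, or `M = {tⁿ}` with `t ∈ s`), then `(M⁻¹A)′ = M⁻¹A` (`s2Mod_eq_bot_of_mem`,
  `s2Mod_eq_bot_of_not_mem`, `s2Mod_awaySub_eq_bot`), every `x` with `m·x ∈ A′` already lies in `B` (`exists_mul_mem_iff_mem_range`), there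
  is an `A`-algebra map `A′ → B` compatible with `K` (`exists_algHom_of_mem`), and under any such map `B` is the localisation of `A′` at
  `M` (`isLocalization_of_algebra`) — the ring form of «`g : Spec_X 𝒜 → X` is a stalk isomorphism off `F`» (memo §2 (a)).

Binder convention: `A K` (the domain and its fraction field), then `B` (the intermediate ring), then `M` with `[IsLocalization M B]`
where a localisation hypothesis is used. [folklore] [cite: EGAIV2, 5.10.16–17] [cite: StacksProject, Tag 0307]
-/

-- single-problem summit: the doubled namespace component is forced
set_option linter.dupNamespace false

noncomputable section

namespace Summit.ResolutionOfSingularities.ResolutionOfSingularities.Theorems.FInjectiveMacaulayfication.S2ModificationAffineLocalization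

open Summit.ResolutionOfSingularities.ResolutionOfSingularities.Theorems.FInjectiveMacaulayfication
open S2ModificationAffine S2ModificationAffineRadical

variable (A : Type) [CommRing A] [IsDomain A] (K : Type) [Field K] [Algebra A K] [IsFractionRing A K]

/-! ## §1 Membership in `A′` subalgebra-wise, and one common denominator for finitely many conditions -/

/-- Membership in `A′ = Ā ∩ ⋂_{f ∈ s} A[1/f]`, subalgebra-wise: integral over `A` and in every `A[1/f]`. [folklore] -/
theorem mem_s2Mod_iff' (s : Finset A) (hs : ∀ f ∈ s, f ≠ 0) (x : K) :
    x ∈ s2Mod A K s hs ↔ IsIntegral A x ∧ ∀ (f : A) (hf : f ∈ s), x ∈ awaySub A K f (hs f hf) := by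
  unfold s2Mod
  rw [Algebra.mem_inf, mem_integralClosure_iff, Algebra.mem_iInf]
  exact and_congr Iff.rfl ⟨fun h f hf => h ⟨f, hf⟩, fun h g => h g.1 g.2⟩

omit [IsDomain A] [IsFractionRing A K] in
/-- **Finitely many denominators have a common one**: if for each `i` of a finite index set some `mᵢ ∈ M` multiplies `x` into the
`A`-subalgebra `Nᵢ ⊆ K`, then one `m ∈ M` (the product) does it for all `i` simultaneously. [folklore] -/
theorem exists_mul_forall_mem {ι : Type} [Finite ι] (M : Submonoid A) (N : ι → Subalgebra A K) (x : K)
    (h : ∀ i, ∃ m ∈ M, algebraMap A K m * x ∈ N i) : ∃ m ∈ M, ∀ i, algebraMap A K m * x ∈ N i := by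
  classical
  cases nonempty_fintype ι
  choose m hmM hmN using h
  refine ⟨∏ i, m i, prod_mem fun i _ => hmM i, fun i => ?_⟩
  rw [← Finset.mul_prod_erase Finset.univ m (Finset.mem_univ i), map_mul,
    mul_comm (algebraMap A K (m i)), mul_assoc]
  exact Subalgebra.mul_mem _ (Subalgebra.algebraMap_mem _ _) (hmN i)

/-! ## §2 An intermediate ring `A → B → K`; localisation hypotheses `[IsLocalization M B]` per statement -/

variable (B : Type) [CommRing B] [IsDomain B] [Algebra A B] [Algebra B K] [IsFractionRing B K] [IsScalarTower A B K]

omit [IsDomain A] [IsFractionRing A K] [IsDomain B] [IsFractionRing B K] in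
/-- **Integral closure commutes with localisation**, elementwise in `K`: `x` is integral over `M⁻¹A` iff `m·x` is integral over `A`
for some `m ∈ M`. [cite: StacksProject, Tag 0307] -/
theorem isIntegral_iff_exists_mul (M : Submonoid A) [IsLocalization M B] (x : K) :
    IsIntegral B x ↔ ∃ m ∈ M, IsIntegral A (algebraMap A K m * x) := by
  constructor
  · intro hx
    obtain ⟨⟨m, hm⟩, hmx⟩ := IsIntegral.exists_multiple_integral_of_isLocalization M (Rₘ := B) x hx
    refine ⟨m, hm, ?_⟩
    rwa [Submonoid.mk_smul, Algebra.smul_def] at hmx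
  · rintro ⟨m, hm, hmx⟩
    have hu : IsUnit (algebraMap A B m) := IsLocalization.map_units B ⟨m, hm⟩
    have hx : x = algebraMap B K ↑(hu.unit⁻¹) * (algebraMap A K m * x) := by
      rw [IsScalarTower.algebraMap_apply A B K m, ← mul_assoc, ← map_mul, hu.val_inv_mul, map_one, one_mul]
    rw [hx]
    exact isIntegral_algebraMap.mul hmx.tower_top

omit [IsDomain A] [IsFractionRing A K] [IsDomain B] [IsFractionRing B K] in
/-- `x = u⁻¹ · (m·x)` with `u` the unit `m` of `B = M⁻¹A`: dividing by `m ∈ M` inside `K` is multiplying by an element of `B`.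
[folklore] -/
theorem eq_algebraMap_inv_mul (M : Submonoid A) [IsLocalization M B] {m : A} (hm : m ∈ M) (x : K) :
    x = algebraMap B K ↑((IsLocalization.map_units B (⟨m, hm⟩ : M)).unit⁻¹) * (algebraMap A K m * x) := by
  rw [IsScalarTower.algebraMap_apply A B K m, ← mul_assoc, ← map_mul, IsUnit.val_inv_mul, map_one, one_mul]

/-- **`A[1/f]` localises to `B[1/f]`**: `x ∈ (M⁻¹A)[1/f]` iff `m·x ∈ A[1/f]` for some `m ∈ M`. [folklore] -/
theorem mem_awaySub_map_iff (M : Submonoid A) [IsLocalization M B] (f : A) (hf : f ≠ 0) (hfB : algebraMap A B f ≠ 0) (x : K) :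
    x ∈ awaySub B K (algebraMap A B f) hfB ↔ ∃ m ∈ M, algebraMap A K m * x ∈ awaySub A K f hf := by
  rw [mem_awaySub_iff]
  constructor
  · rintro ⟨b, n, rfl⟩
    obtain ⟨⟨a, ⟨m, hm⟩⟩, hb⟩ := IsLocalization.surj M b
    -- `hb : b * algebraMap A B m = algebraMap A B a`
    refine ⟨m, hm, (mem_awaySub_iff A K f hf _).mpr ⟨a, n, ?_⟩⟩
    rw [← map_pow, ← IsScalarTower.algebraMap_apply A B K, ← mul_assoc, IsScalarTower.algebraMap_apply A B K m,
      ← map_mul, mul_comm (algebraMap A B m) b]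
    change algebraMap B K (b * algebraMap A B ((⟨m, hm⟩ : M) : A)) * _ = _
    rw [hb, ← IsScalarTower.algebraMap_apply A B K]
  · rintro ⟨m, hm, hmx⟩
    obtain ⟨a, n, ha⟩ := (mem_awaySub_iff A K f hf _).mp hmx
    refine ⟨↑((IsLocalization.map_units B (⟨m, hm⟩ : M)).unit⁻¹) * algebraMap A B a, n, ?_⟩
    rw [eq_algebraMap_inv_mul A K B M hm x, ha, map_mul, ← IsScalarTower.algebraMap_apply A B K a, ← map_pow,
      ← IsScalarTower.algebraMap_apply A B K, mul_assoc]

omit [IsDomain A] [IsDomain B] [IsFractionRing B K] in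
/-- The images in `B` of the non-zero generators are non-zero, already in `K` (`A → B → K` is injective). [folklore] -/
theorem image_ne_zero [DecidableEq B] (s : Finset A) (hs : ∀ f ∈ s, f ≠ 0) :
    ∀ g ∈ s.image (algebraMap A B), algebraMap B K g ≠ 0 ∧ g ≠ 0 := by
  intro g hg
  obtain ⟨f, hf, rfl⟩ := Finset.mem_image.mp hg
  have hK : algebraMap B K (algebraMap A B f) ≠ 0 := by
    rw [← IsScalarTower.algebraMap_apply A B K]
    exact algebraMap_ne_zero A K (hs f hf)
  exact ⟨hK, fun h => hK (by rw [h, map_zero])⟩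

omit [IsDomain A] [IsDomain B] in
/-- The ideal of `B` generated by the image finset is the extension of `(s)`. [folklore] -/
theorem span_image_eq_map [DecidableEq B] (s : Finset A) :
    Ideal.span ((s.image (algebraMap A B) : Finset B) : Set B) = (Ideal.span (s : Set A)).map (algebraMap A B) := by
  rw [Finset.coe_image, Ideal.map_span]

/-- **`(M⁻¹A)′ = M⁻¹(A′)` for the image generators**: with `s′ = image of s` in `B`, `x ∈ (M⁻¹A)′` iff `m·x ∈ A′` for some `m ∈ M`.
(Integral closure and each `A[1/f]` localise; the finitely many denominators are merged by `exists_mul_forall_mem`.) [folklore] -/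
theorem mem_s2Mod_image_iff (M : Submonoid A) [IsLocalization M B] [DecidableEq B] (s : Finset A) (hs : ∀ f ∈ s, f ≠ 0)
    (hsB : ∀ g ∈ s.image (algebraMap A B), g ≠ 0) (x : K) :
    x ∈ s2Mod B K (s.image (algebraMap A B)) hsB ↔ ∃ m ∈ M, algebraMap A K m * x ∈ s2Mod A K s hs := by
  constructor
  · intro hx
    rw [mem_s2Mod_iff'] at hx
    obtain ⟨m₀, hm₀, hm₀x⟩ := (isIntegral_iff_exists_mul A K B M x).mp hx.1
    have haw : ∀ f : s, ∃ m ∈ M, algebraMap A K m * x ∈ awaySub A K f.1 (hs f.1 f.2) := by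
      rintro ⟨f, hf⟩
      have hfB : algebraMap A B f ∈ s.image (algebraMap A B) := Finset.mem_image_of_mem _ hf
      exact (mem_awaySub_map_iff A K B M f (hs f hf) (hsB _ hfB) x).mp (hx.2 _ hfB)
    obtain ⟨m₁, hm₁, hm₁x⟩ := exists_mul_forall_mem A K M (fun f : s => awaySub A K f.1 (hs f.1 f.2)) x haw
    refine ⟨m₁ * m₀, mul_mem hm₁ hm₀, (mem_s2Mod_iff' A K s hs _).mpr ⟨?_, fun f hf => ?_⟩⟩
    · rw [map_mul, mul_assoc]
      exact isIntegral_algebraMap.mul hm₀x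
    · rw [map_mul, mul_comm (algebraMap A K m₁), mul_assoc]
      exact Subalgebra.mul_mem _ (Subalgebra.algebraMap_mem _ m₀) (hm₁x ⟨f, hf⟩)
  · rintro ⟨m, hm, hmx⟩
    rw [mem_s2Mod_iff'] at hmx ⊢
    refine ⟨(isIntegral_iff_exists_mul A K B M x).mpr ⟨m, hm, hmx.1⟩, fun g hg => ?_⟩
    obtain ⟨f, hf, rfl⟩ := Finset.mem_image.mp hg
    exact (mem_awaySub_map_iff A K B M f (hs f hf) (hsB _ hg) x).mpr ⟨m, hm, hmx.2 f hf⟩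

/-! ## §3 The main statement: `(M⁻¹A)′ = M⁻¹(A′)` inside `K`, for any generators of the right radical -/

/-- **The affine S₂-modification algebra commutes with localisation.** For `B = M⁻¹A` in the tower `A → B → K` and any finite set
`s′ ⊆ B ∖ {0}` with `√(s′) = √((s)·B)`: `x ∈ (M⁻¹A)′ = s2Mod B K s′` iff `m·x ∈ A′ = s2Mod A K s` for some `m ∈ M`.
[folklore] [cite: EGAIV2, 5.10.16–17] -/
theorem mem_s2Mod_iff_exists_mul_mem (M : Submonoid A) [IsLocalization M B] (s : Finset A) (hs : ∀ f ∈ s, f ≠ 0)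
    (s' : Finset B) (hs' : ∀ g ∈ s', g ≠ 0)
    (hrad : (Ideal.span (s' : Set B)).radical = ((Ideal.span (s : Set A)).map (algebraMap A B)).radical) (x : K) :
    x ∈ s2Mod B K s' hs' ↔ ∃ m ∈ M, algebraMap A K m * x ∈ s2Mod A K s hs := by
  classical
  have hsB : ∀ g ∈ s.image (algebraMap A B), g ≠ 0 := fun g hg => (image_ne_zero A K B s hs g hg).2
  have heq : s2Mod B K s' hs' = s2Mod B K (s.image (algebraMap A B)) hsB :=
    s2Mod_eq_of_radical B K s' _ hs' hsB (by rw [hrad, span_image_eq_map A B s])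
  rw [heq]
  exact mem_s2Mod_image_iff A K B M s hs hsB x

/-- **`A′ ⊆ B′` for any intermediate ring `A ⊆ B ⊆ K`** (no localisation hypothesis): integral over `A` ⇒ integral over `B`,
`a/fⁿ ∈ A[1/f]` ⇒ `a/fⁿ ∈ B[1/f]`. [folklore] -/
theorem s2Mod_le_restrictScalars (s : Finset A) (hs : ∀ f ∈ s, f ≠ 0) (s' : Finset B) (hs' : ∀ g ∈ s', g ≠ 0)
    (hrad : (Ideal.span (s' : Set B)).radical = ((Ideal.span (s : Set A)).map (algebraMap A B)).radical) :
    s2Mod A K s hs ≤ (s2Mod B K s' hs').restrictScalars A := by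
  classical
  have hsB : ∀ g ∈ s.image (algebraMap A B), g ≠ 0 := fun g hg => (image_ne_zero A K B s hs g hg).2
  have heq : s2Mod B K s' hs' = s2Mod B K (s.image (algebraMap A B)) hsB :=
    s2Mod_eq_of_radical B K s' _ hs' hsB (by rw [hrad, span_image_eq_map A B s])
  intro x hx
  rw [Subalgebra.mem_restrictScalars, heq, mem_s2Mod_iff']
  rw [mem_s2Mod_iff'] at hx
  refine ⟨hx.1.tower_top, fun g hg => ?_⟩
  obtain ⟨f, hf, rfl⟩ := Finset.mem_image.mp hg
  obtain ⟨a, n, ha⟩ := (mem_awaySub_iff A K f (hs f hf) x).mp (hx.2 f hf)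
  refine (mem_awaySub_iff B K _ (hsB _ hg) x).mpr ⟨algebraMap A B a, n, ?_⟩
  rw [ha, ← map_pow, ← IsScalarTower.algebraMap_apply A B K, ← IsScalarTower.algebraMap_apply A B K]

omit [IsDomain A] [IsFractionRing A K] in
/-- `B ⊆ B′`. [folklore] -/
theorem range_le_restrictScalars (s' : Finset B) (hs' : ∀ g ∈ s', g ≠ 0) :
    (IsScalarTower.toAlgHom A B K).range ≤ (s2Mod B K s' hs').restrictScalars A := by
  rintro _ ⟨b, rfl⟩
  exact Subalgebra.algebraMap_mem (s2Mod B K s' hs') b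

/-- **`(M⁻¹A)′ = A′ · B` inside `K`**: as an `A`-subalgebra of `K`, the S₂-modification algebra of the localisation is generated by
`A′` and `B = M⁻¹A`. [folklore] -/
theorem restrictScalars_s2Mod_eq_sup (M : Submonoid A) [IsLocalization M B] (s : Finset A) (hs : ∀ f ∈ s, f ≠ 0)
    (s' : Finset B) (hs' : ∀ g ∈ s', g ≠ 0)
    (hrad : (Ideal.span (s' : Set B)).radical = ((Ideal.span (s : Set A)).map (algebraMap A B)).radical) :
    (s2Mod B K s' hs').restrictScalars A = s2Mod A K s hs ⊔ (IsScalarTower.toAlgHom A B K).range := by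
  refine le_antisymm (fun x hx => ?_)
    (sup_le (s2Mod_le_restrictScalars A K B s hs s' hs' hrad) (range_le_restrictScalars A K B s' hs'))
  rw [Subalgebra.mem_restrictScalars, mem_s2Mod_iff_exists_mul_mem A K B M s hs s' hs' hrad] at hx
  obtain ⟨m, hm, hmx⟩ := hx
  rw [eq_algebraMap_inv_mul A K B M hm x, mul_comm]
  exact Algebra.mul_mem_sup hmx ⟨_, rfl⟩

/-! ## §4 `(M⁻¹A)′` is the localisation of the ring `A′` at `M` -/

/-- **There is an `A`-algebra map `A′ → B′` compatible with the inclusions into `K`** (the inclusion of subsets of `K`; any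
intermediate ring `B`). [folklore] -/
theorem exists_algHom_s2Mod (s : Finset A) (hs : ∀ f ∈ s, f ≠ 0) (s' : Finset B) (hs' : ∀ g ∈ s', g ≠ 0)
    (hrad : (Ideal.span (s' : Set B)).radical = ((Ideal.span (s : Set A)).map (algebraMap A B)).radical) :
    ∃ φ : s2Mod A K s hs →ₐ[A] s2Mod B K s' hs', ∀ y, (φ y : K) = y := by
  have hle := s2Mod_le_restrictScalars A K B s hs s' hs' hrad
  refine ⟨{ toFun := fun y => ⟨(y : K), hle y.2⟩
            map_one' := Subtype.ext (by simp)
            map_mul' := fun y z => Subtype.ext (by simp)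
            map_zero' := Subtype.ext (by simp)
            map_add' := fun y z => Subtype.ext (by simp)
            commutes' := fun a => Subtype.ext (by simp) }, fun y => rfl⟩

/-- **`(M⁻¹A)′ = M⁻¹(A′)` as a localisation.** Under any algebra `A′ → (M⁻¹A)′` compatible with the inclusions into `K`
(`exists_algHom_s2Mod`), the ring `(M⁻¹A)′` satisfies `IsLocalization` for the image of `M` in `A′`: every element is `y/m` with
`y ∈ A′`, `m ∈ M`, the `m ∈ M` become units, and `A′ → (M⁻¹A)′` is injective. (What the gluing of the `Spec A′` along basic opens and
the stalk computations consume.) [folklore] [cite: EGAIV2, 5.10.16–17] -/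
theorem isLocalization_s2Mod (M : Submonoid A) [IsLocalization M B] (s : Finset A) (hs : ∀ f ∈ s, f ≠ 0)
    (s' : Finset B) (hs' : ∀ g ∈ s', g ≠ 0)
    (hrad : (Ideal.span (s' : Set B)).radical = ((Ideal.span (s : Set A)).map (algebraMap A B)).radical)
    [Algebra (s2Mod A K s hs) (s2Mod B K s' hs')]
    (hcompat : ∀ y : s2Mod A K s hs, ((algebraMap (s2Mod A K s hs) (s2Mod B K s' hs') y : s2Mod B K s' hs') : K) = y) :
    IsLocalization (Algebra.algebraMapSubmonoid (s2Mod A K s hs) M) (s2Mod B K s' hs') := by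
  refine ⟨?_, ?_, ?_⟩
  · rintro ⟨_, ⟨m, hm, rfl⟩⟩
    have hmK : algebraMap A K m ≠ 0 := by
      rw [IsScalarTower.algebraMap_apply A B K]
      exact fun h => (IsLocalization.map_units B (⟨m, hm⟩ : M)).ne_zero (IsFractionRing.injective B K (by rw [h, map_zero]))
    have hinv : (algebraMap A K m)⁻¹ ∈ s2Mod B K s' hs' := by
      have : (algebraMap A K m)⁻¹ = algebraMap B K ↑((IsLocalization.map_units B (⟨m, hm⟩ : M)).unit⁻¹) := by
        apply inv_eq_of_mul_eq_one_right
        rw [IsScalarTower.algebraMap_apply A B K m, ← map_mul, IsUnit.mul_val_inv, map_one]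
      rw [this]
      exact Subalgebra.algebraMap_mem _ _
    refine IsUnit.of_mul_eq_one ⟨(algebraMap A K m)⁻¹, hinv⟩ (Subtype.ext ?_)
    change ((algebraMap (s2Mod A K s hs) (s2Mod B K s' hs') (algebraMap A (s2Mod A K s hs) m) : s2Mod B K s' hs') : K)
      * (algebraMap A K m)⁻¹ = 1
    rw [hcompat, Subalgebra.coe_algebraMap, mul_inv_cancel₀ hmK]
  · intro z
    obtain ⟨m, hm, hmz⟩ := (mem_s2Mod_iff_exists_mul_mem A K B M s hs s' hs' hrad (z : K)).mp z.2
    refine ⟨⟨⟨algebraMap A K m * z, hmz⟩, ⟨algebraMap A (s2Mod A K s hs) m, Algebra.mem_algebraMapSubmonoid_of_mem ⟨m, hm⟩⟩⟩,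
      Subtype.ext ?_⟩
    change ((z : K) * ((algebraMap (s2Mod A K s hs) (s2Mod B K s' hs') (algebraMap A (s2Mod A K s hs) m) : s2Mod B K s' hs') : K))
      = ((algebraMap (s2Mod A K s hs) (s2Mod B K s' hs') ⟨algebraMap A K m * z, hmz⟩ : s2Mod B K s' hs') : K)
    rw [hcompat, hcompat, Subalgebra.coe_algebraMap, mul_comm]
  · intro y₁ y₂ h
    refine ⟨1, ?_⟩
    have h' := congrArg (fun w : s2Mod B K s' hs' => (w : K)) h
    simp only [hcompat] at h'
    rw [Subtype.ext h']

/-! ## §5 Off `V(𝔟)`: when `M` meets `s`, the modification is trivial after localising -/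

omit [IsDomain A] in
/-- **If `M` meets `s` then `(M⁻¹A)′ = M⁻¹A`** (the bottom subalgebra of `K` over `B`): a generator became a unit.
(E.g. `M = {tⁿ}` with `t ∈ s` — the chart `D(t)` misses `V(s)`.) [folklore] -/
theorem s2Mod_eq_bot_of_mem (M : Submonoid A) [IsLocalization M B] (s : Finset A) (hs : ∀ f ∈ s, f ≠ 0)
    (s' : Finset B) (hs' : ∀ g ∈ s', g ≠ 0)
    (hrad : (Ideal.span (s' : Set B)).radical = ((Ideal.span (s : Set A)).map (algebraMap A B)).radical)
    (h : ∃ f ∈ s, f ∈ M) : s2Mod B K s' hs' = ⊥ := by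
  classical
  obtain ⟨f, hfs, hfM⟩ := h
  have hsB : ∀ g ∈ s.image (algebraMap A B), g ≠ 0 := fun g hg => (image_ne_zero A K B s hs g hg).2
  have heq : s2Mod B K s' hs' = s2Mod B K (s.image (algebraMap A B)) hsB :=
    s2Mod_eq_of_radical B K s' _ hs' hsB (by rw [hrad, span_image_eq_map A B s])
  rw [heq]
  exact s2Mod_eq_bot_of_isUnit B K _ hsB (algebraMap A B f) (Finset.mem_image_of_mem _ hfs)
    (IsLocalization.map_units B (⟨f, hfM⟩ : M))

/-- **Off `V(𝔟)`, `M⁻¹(A′) = M⁻¹A`**: if `M` meets `s`, an `x ∈ K` with `m·x ∈ A′` for some `m ∈ M` already lies in `B`, and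
conversely. (Ring form of «`A′ ⊗ A_𝔭 = A_𝔭` for `𝔭 ∉ V(𝔟)`», memo §2 (a).) [folklore] -/
theorem exists_mul_mem_iff_mem_range (M : Submonoid A) [IsLocalization M B] (s : Finset A) (hs : ∀ f ∈ s, f ≠ 0)
    (h : ∃ f ∈ s, f ∈ M) (x : K) :
    (∃ m ∈ M, algebraMap A K m * x ∈ s2Mod A K s hs) ↔ x ∈ Set.range (algebraMap B K) := by
  classical
  have hsB : ∀ g ∈ s.image (algebraMap A B), g ≠ 0 := fun g hg => (image_ne_zero A K B s hs g hg).2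
  rw [← mem_s2Mod_image_iff A K B M s hs hsB x,
    s2Mod_eq_bot_of_mem A K B M s hs _ hsB (by rw [span_image_eq_map A B s]) h, Algebra.mem_bot]

omit [IsDomain A] in
/-- **The prime-ideal form**: for `Aₚ = A_𝔭` with `𝔭 ⊉ (s)` (a point of `Spec A` off `V(𝔟)`), `(A_𝔭)′ = A_𝔭`. [folklore] -/
theorem s2Mod_eq_bot_of_not_mem (𝔭 : Ideal A) [𝔭.IsPrime] (Aₚ : Type) [CommRing Aₚ] [IsDomain Aₚ] [Algebra A Aₚ]
    [IsLocalization.AtPrime Aₚ 𝔭] [Algebra Aₚ K] [IsFractionRing Aₚ K] [IsScalarTower A Aₚ K]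
    (s : Finset A) (hs : ∀ f ∈ s, f ≠ 0) (s' : Finset Aₚ) (hs' : ∀ g ∈ s', g ≠ 0)
    (hrad : (Ideal.span (s' : Set Aₚ)).radical = ((Ideal.span (s : Set A)).map (algebraMap A Aₚ)).radical)
    (h : ∃ f ∈ s, f ∉ 𝔭) : s2Mod Aₚ K s' hs' = ⊥ :=
  s2Mod_eq_bot_of_mem A K Aₚ 𝔭.primeCompl s hs s' hs' hrad (h.imp fun _ hf => ⟨hf.1, hf.2⟩)

/-- **An `A`-algebra map `A′ → B` off `V(𝔟)`**: if `M` meets `s`, `A′ ⊆ M⁻¹A` inside `K`, so there is `φ : A′ →ₐ[A] B` compatible with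
the inclusions into `K` (unique, `B → K` being injective). [folklore] -/
theorem exists_algHom_of_mem (M : Submonoid A) [IsLocalization M B] (s : Finset A) (hs : ∀ f ∈ s, f ≠ 0)
    (h : ∃ f ∈ s, f ∈ M) :
    ∃ φ : s2Mod A K s hs →ₐ[A] B, ∀ y, algebraMap B K (φ y) = y := by
  have hmem : ∀ y : s2Mod A K s hs, (y : K) ∈ Set.range (algebraMap B K) := fun y =>
    (exists_mul_mem_iff_mem_range A K B M s hs h (y : K)).mp ⟨1, one_mem M, by rw [map_one, one_mul]; exact y.2⟩
  choose g hg using hmem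
  have hinj : Function.Injective (algebraMap B K) := IsFractionRing.injective B K
  refine ⟨{ toFun := g
            map_one' := hinj (by rw [hg, map_one]; rfl)
            map_mul' := fun y z => hinj (by rw [hg, map_mul, hg, hg]; rfl)
            map_zero' := hinj (by rw [hg, map_zero]; rfl)
            map_add' := fun y z => hinj (by rw [hg, map_add, hg, hg]; rfl)
            commutes' := fun a => hinj (by rw [hg, ← IsScalarTower.algebraMap_apply, Subalgebra.coe_algebraMap]) }, hg⟩

/-- **`B = M⁻¹A` is the localisation of `A′` at `M` as soon as `A′` maps to `B` compatibly with `K`.** Under any `A`-algebra map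
`A′ → B` compatible with `K` (it exists iff `A′ ⊆ B` inside `K`, e.g. off `V(𝔟)` by `exists_algHom_of_mem`), `IsLocalization (M·A′) B`:
the stalk / basic-open ring of `Spec A` off `V(𝔟)` is also that of `Spec A′` — «`g` is an isomorphism off `F`». [folklore] -/
theorem isLocalization_of_algebra (M : Submonoid A) [IsLocalization M B] (s : Finset A) (hs : ∀ f ∈ s, f ≠ 0)
    [Algebra (s2Mod A K s hs) B]
    (hcompat : ∀ y : s2Mod A K s hs, algebraMap B K (algebraMap (s2Mod A K s hs) B y) = y) :
    IsLocalization (Algebra.algebraMapSubmonoid (s2Mod A K s hs) M) B := by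
  classical
  have hinj : Function.Injective (algebraMap B K) := IsFractionRing.injective B K
  have hAm : ∀ m : A, algebraMap (s2Mod A K s hs) B (algebraMap A (s2Mod A K s hs) m) = algebraMap A B m := fun m =>
    hinj (by rw [hcompat, Subalgebra.coe_algebraMap, IsScalarTower.algebraMap_apply A B K])
  refine ⟨?_, ?_, ?_⟩
  · rintro ⟨_, ⟨m, hm, rfl⟩⟩
    change IsUnit (algebraMap (s2Mod A K s hs) B (algebraMap A (s2Mod A K s hs) m))
    rw [hAm]
    exact IsLocalization.map_units B (⟨m, hm⟩ : M)
  · intro z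
    -- `z ∈ B ⊆ (M⁻¹A)′`, so `m·z ∈ A′` for some `m ∈ M`
    have hsB : ∀ g ∈ s.image (algebraMap A B), g ≠ 0 := fun g hg => (image_ne_zero A K B s hs g hg).2
    obtain ⟨m, hm, hmz⟩ :=
      (mem_s2Mod_image_iff A K B M s hs hsB (algebraMap B K z)).mp (Subalgebra.algebraMap_mem _ z)
    refine ⟨⟨⟨algebraMap A K m * algebraMap B K z, hmz⟩,
      ⟨algebraMap A (s2Mod A K s hs) m, Algebra.mem_algebraMapSubmonoid_of_mem ⟨m, hm⟩⟩⟩, hinj ?_⟩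
    change algebraMap B K (z * algebraMap (s2Mod A K s hs) B (algebraMap A (s2Mod A K s hs) m))
      = algebraMap B K (algebraMap (s2Mod A K s hs) B ⟨algebraMap A K m * algebraMap B K z, hmz⟩)
    rw [hcompat, map_mul, hAm, ← IsScalarTower.algebraMap_apply A B K, mul_comm]
  · intro y₁ y₂ h
    refine ⟨1, ?_⟩
    have h' := congrArg (algebraMap B K) h
    rw [hcompat, hcompat] at h'
    rw [Subtype.ext h']

/-! ## §6 The basic-open case `B = A[1/t]`: `Γ(D(t), 𝒜) = A′[1/t]` -/

/-- **`(A[1/t])′ = A′[1/t]` inside `K`** (`t ≠ 0`; `A[1/t] = awaySub A K t ht`): `x ∈ (A[1/t])′` iff `tⁿ·x ∈ A′` for some `n`. With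
`…Radical.s2Mod_eq_of_radical` (any generators of the ideal of `V(s) ∩ D(t)` may be used) this says that the value of the sheaf
`𝒜 = ν_*𝒪 ∩ j_*𝒪_U` on a basic open is the localisation of its value on the chart — `𝒜` is a quasi-coherent `𝒪`-algebra and the
`Spec A′` glue along basic opens (memo §2, L4). [folklore] [cite: EGAIV2, 5.10.16–17] -/
theorem mem_s2Mod_awaySub_iff (t : A) (ht : t ≠ 0) (s : Finset A) (hs : ∀ f ∈ s, f ≠ 0)
    (s' : Finset (awaySub A K t ht)) (hs' : ∀ g ∈ s', g ≠ 0)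
    (hrad : (Ideal.span (s' : Set (awaySub A K t ht))).radical
      = ((Ideal.span (s : Set A)).map (algebraMap A (awaySub A K t ht))).radical) (x : K) :
    x ∈ s2Mod (awaySub A K t ht) K s' hs' ↔ ∃ n : ℕ, algebraMap A K t ^ n * x ∈ s2Mod A K s hs := by
  haveI : IsLocalization (Submonoid.powers t) (awaySub A K t ht) :=
    Localization.subalgebra.isLocalization_ofField K (Submonoid.powers t) (powers_le_nonZeroDivisors_of_noZeroDivisors ht)
  rw [mem_s2Mod_iff_exists_mul_mem A K (awaySub A K t ht) (Submonoid.powers t) s hs s' hs' hrad x]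
  constructor
  · rintro ⟨_, ⟨n, rfl⟩, h⟩
    exact ⟨n, by rwa [map_pow] at h⟩
  · rintro ⟨n, h⟩
    exact ⟨t ^ n, ⟨n, rfl⟩, by rwa [map_pow]⟩

/-- **On a basic open missing `V(s)` nothing happens**: for `t ∈ s`, `(A[1/t])′ = A[1/t]`, i.e. `x` with `tⁿ·x ∈ A′` lies in `A[1/t]`
(cf. `S2ModificationAffine.exists_eq_mul_inv_pow`). [folklore] -/
theorem s2Mod_awaySub_eq_bot (t : A) (ht : t ≠ 0) (s : Finset A) (hs : ∀ f ∈ s, f ≠ 0) (hts : t ∈ s)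
    (s' : Finset (awaySub A K t ht)) (hs' : ∀ g ∈ s', g ≠ 0)
    (hrad : (Ideal.span (s' : Set (awaySub A K t ht))).radical
      = ((Ideal.span (s : Set A)).map (algebraMap A (awaySub A K t ht))).radical) :
    s2Mod (awaySub A K t ht) K s' hs' = ⊥ := by
  haveI : IsLocalization (Submonoid.powers t) (awaySub A K t ht) :=
    Localization.subalgebra.isLocalization_ofField K (Submonoid.powers t) (powers_le_nonZeroDivisors_of_noZeroDivisors ht)
  exact s2Mod_eq_bot_of_mem A K (awaySub A K t ht) (Submonoid.powers t) s hs s' hs' hrad ⟨t, hts, Submonoid.mem_powers t⟩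

end Summit.ResolutionOfSingularities.ResolutionOfSingularities.Theorems.FInjectiveMacaulayfication.S2ModificationAffineLocalization

end
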